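import Summits.AtomisticToContinuum.HydrodynamicLimit.Theorems.JParityClosureKineticEnergyTailsApriori
import HarnessLib

/-!
# `CollisionActivityTails` (stmt-AtomisticToContinuum-13734), line `SketchK1`: mean energy bound

Helper file (`--supports stmt-AtomisticToContinuum-13734`) for the crux
`Summit.AtomisticToContinuum.HydrodynamicLimit.Theses.OneFlightGossipEngine.CollisionActivityTails`
(shared with `…Theses.TwoClocks.CollisionActivityTails`), skeleton line `SketchK1`, registered stub
`stub_meanEnergyBound`.

The line dominates the window collisional activity of a tagged sphere by three functionals; the
endpoint functional is priced by energy conservation, and the only probabilistic input of that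
branch is the statics fact proved here: under the local Gibbs law
`localGibbsLaw σ a₀ u₀ θ₀ N Φ = localGibbsMeasure σ a₀ u₀ θ₀ N` (density
`∝ 𝟙_{hard core} ∏ᵢ a₀(xᵢ) M_{1,u₀(xᵢ),θ₀(xᵢ)}(vᵢ)`), the mean kinetic energy is at most
`e₀ (N + 1)` with `e₀ = sup |u₀|² / 2 + 3 sup θ₀ / 2 + 1`, uniformly in `N`, in `σ` and in the flow.

Proof. `E(z) = ((N+1)/2) · (N+1)⁻¹ Σᵢ |vᵢ|²`, and the disintegration bound for one-body velocity
observables `lintegral_meanVelObs_localGibbsMeasure_le`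
(`Theorems/JParityClosureKineticEnergyTailsApriori.lean`: conditionally on the positions the
velocities are independent Gaussians `⊗ᵢ N(u₀(xᵢ), θ₀(xᵢ) id)`, the position marginal has total
mass `≤ 1`) with `f = |·|²` and the Gaussian second moment
`∫ |v|² dN(u, θ id) = |u|² + 3θ ≤ sup |u₀|² + 3 sup θ₀` (`lintegral_norm_sq_gaussMeasure`) give
`∫ (N+1)⁻¹ Σᵢ |vᵢ|² dλ_N ≤ sup |u₀|² + 3 sup θ₀`; the bounds `sup |u₀|`, `sup θ₀` exist by
compactness of `𝕋³` (`exists_forall_abs_le_of_continuous`).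

References: H. Spohn, *Large Scale Dynamics of Interacting Particles* (1991), Part I §2.3 (local
equilibrium states); the Gaussian second moment is folklore.
-/

noncomputable section

open MeasureTheory ProbabilityTheory Set Filter
open scoped ENNReal

namespace Summit.AtomisticToContinuum.HydrodynamicLimit.Theorems.CollisionActivityTailsMeanEnergyBound

open Literature.MathematicalPhysics.KineticTheory Literature.Analysis.FluidPDE

/-! ## Vocabulary of the line (verbatim from the skeleton `SketchK1`) -/

/-- A hard-sphere flow of `N + 1` spheres of reduced diameter `σ` on `𝕋³` (the crux's `Φ N`). -/
abbrev Flow (σ : ℝ) (N : ℕ) : Type :=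
  HardSphereFlow (Torus.geometry (Fin 3)) (hsDiameter σ N) (N + 1)

/-- **MEAN ENERGY BOUND** (statics of the local Gibbs law; stub 3). For continuous profiles the mean kinetic energy per
particle under the local Gibbs law is bounded uniformly in `N` and `σ ≤ 1/2` (Gaussian velocity marginal:
`E|v_i|² = |u₀(x_i)|² + 3 θ₀(x_i) ≤ sup |u₀|² + 3 sup θ₀`; the law is the zero measure when the spheres do not fit). -/
def MeanEnergyBound : Prop :=
  ∀ (a₀ θ₀ : T3 → ℝ) (u₀ : T3 → V3), Continuous a₀ → Continuous θ₀ → Continuous u₀ →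
    (∀ x, 0 < a₀ x) → (∀ x, 0 < θ₀ x) → ∃ e₀ : ℝ, 0 < e₀ ∧ ∀ (σ : ℝ), 0 < σ → σ ≤ 1 / 2 →
    ∀ (N : ℕ) (Φ : Flow σ N),
      ∫⁻ z, ENNReal.ofReal (configEnergy z) ∂(localGibbsLaw σ a₀ u₀ θ₀ N Φ) ≤
        ENNReal.ofReal (e₀ * ((N : ℝ) + 1))

/-! ## The stub -/

/-- The kinetic energy as a multiple of the mean one-body observable `|v|²`:
`E(z) = ((N+1)/2) · (N+1)⁻¹ Σᵢ |vᵢ|²`, in `ℝ≥0∞`. -/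
theorem ofReal_configEnergy_eq (N : ℕ) (z : Config (N + 1) (Fin 3) T3) :
    ENNReal.ofReal (configEnergy z) =
      ENNReal.ofReal (((N : ℝ) + 1) / 2) *
        ENNReal.ofReal (((N : ℝ) + 1)⁻¹ * ∑ i, ‖(z i).2‖ ^ 2) := by
  rw [← ENNReal.ofReal_mul (by positivity), configEnergy]
  congr 1
  have hN : (N : ℝ) + 1 ≠ 0 := by positivity
  field_simp

/-- **STUB 3 of line `SketchK1` (mean energy bound).** For continuous profiles `a₀, θ₀ > 0`, `u₀`
there is `e₀ > 0` (namely `sup |u₀|²/2 + 3 sup θ₀/2 + 1`) with `∫ E dλ_N ≤ e₀ (N + 1)` for every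
`σ`, every `N` and every flow, `λ_N` the local Gibbs law: disintegration into positions and
independent Gaussian velocities (`lintegral_meanVelObs_localGibbsMeasure_le` with `f = |·|²`) and the
Gaussian second moment `lintegral_norm_sq_gaussMeasure`. -/
theorem stub_meanEnergyBound : MeanEnergyBound := by
  intro a₀ θ₀ u₀ ha hθ hu ha0 hθ0
  obtain ⟨Θ, hΘ0, hΘ⟩ := exists_forall_abs_le_of_continuous hθ
  obtain ⟨U, hU0, hU⟩ := exists_forall_abs_le_of_continuous hu.norm
  have hΘ' : ∀ y, θ₀ y ≤ Θ := fun y => (le_abs_self _).trans (hΘ y)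
  have hU' : ∀ y, ‖u₀ y‖ ≤ U := fun y => (le_abs_self _).trans (hU y)
  refine ⟨U ^ 2 / 2 + 3 * Θ / 2 + 1, by positivity, ?_⟩
  intro σ _hσ _hσ2 N Φ
  have ha0' : ∀ x, 0 ≤ a₀ x := fun x => (ha0 x).le
  have hB : ∀ y : T3, ∫⁻ w, ENNReal.ofReal (‖w‖ ^ 2) ∂gaussMeasure (u₀ y) (θ₀ y) ≤
      ENNReal.ofReal (U ^ 2 + 3 * Θ) := by
    intro y
    rw [lintegral_norm_sq_gaussMeasure (u₀ y) (hθ0 y)]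
    refine ENNReal.ofReal_le_ofReal ?_
    have hUy : ‖u₀ y‖ ^ 2 ≤ U ^ 2 := pow_le_pow_left₀ (norm_nonneg _) (hU' y) 2
    linarith [hΘ' y]
  have hmean : ∫⁻ z, ENNReal.ofReal (((N : ℝ) + 1)⁻¹ * ∑ i, ‖(z i).2‖ ^ 2)
      ∂localGibbsMeasure σ a₀ u₀ θ₀ N ≤ ENNReal.ofReal (U ^ 2 + 3 * Θ) :=
    lintegral_meanVelObs_localGibbsMeasure_le ha hθ hu ha0' hθ0 (f := fun v : V3 => ‖v‖ ^ 2)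
      (by fun_prop) (fun v => sq_nonneg _) hB σ N
  rw [localGibbsLaw_eq]
  simp_rw [ofReal_configEnergy_eq N]
  rw [lintegral_const_mul' _ _ ENNReal.ofReal_ne_top]
  calc ENNReal.ofReal (((N : ℝ) + 1) / 2) *
        ∫⁻ z, ENNReal.ofReal (((N : ℝ) + 1)⁻¹ * ∑ i, ‖(z i).2‖ ^ 2) ∂localGibbsMeasure σ a₀ u₀ θ₀ N
      ≤ ENNReal.ofReal (((N : ℝ) + 1) / 2) * ENNReal.ofReal (U ^ 2 + 3 * Θ) :=
        mul_le_mul_right hmean _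
    _ = ENNReal.ofReal ((U ^ 2 / 2 + 3 * Θ / 2) * ((N : ℝ) + 1)) := by
        rw [← ENNReal.ofReal_mul (by positivity)]
        congr 1
        ring
    _ ≤ ENNReal.ofReal ((U ^ 2 / 2 + 3 * Θ / 2 + 1) * ((N : ℝ) + 1)) :=
        ENNReal.ofReal_le_ofReal (mul_le_mul_of_nonneg_right (by linarith) (by positivity))

end Summit.AtomisticToContinuum.HydrodynamicLimit.Theorems.CollisionActivityTailsMeanEnergyBound
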